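import Summits.AtomisticToContinuum.BoseEinsteinCondensation.Theses.BECDressedKac

/-!
# AtomisticToContinuum / BoseEinsteinCondensation — route `BECDressedKac`, assembly

Settles the assembly item `stmt-AtomisticToContinuum-14635` of route
`route-AtomisticToContinuum-BECDressedKac`: the implication
`SplittingConstruction → DressedKacCondensation → WindowArithmetic → BoundaryTransferWeak →
BoseEinsteinCondensation` (the sub-problem Statement decl).

The hypotheses of `Assembly` are, verbatim and in the same order, those of the route's deciding
theorem `closes`, so the assembly is that theorem curried; the composition is spelled out again
below for the record: fix a repulsive finite-range potential `v`; `WindowArithmetic` applied to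
`SplittingConstruction` and `DressedKacCondensation` gives `PeriodicBEC`, hence its body for `v`
(constant-mode condensation of near-minimisers on the torus at all small densities), and
`BoundaryTransferWeak` turns that body into `∃ ρ₀ > 0, ∀ ρ ∈ (0, ρ₀), HasGroundStateBEC v ρ`, which
is the sub-problem statement `BoseEinsteinCondensation` at `v`. Pure logic; no analytic content
lives here.
-/

namespace Summit.AtomisticToContinuum.BoseEinsteinCondensation.Theorems

/-- Settles `stmt-AtomisticToContinuum-14635` (exact signature): the assembly of route
`BECDressedKac`, i.e. its items `SplittingConstruction`, `DressedKacCondensation`,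
`WindowArithmetic` and `BoundaryTransferWeak` imply the sub-problem statement
`BoseEinsteinCondensation`. Proof: for each repulsive finite-range `v`, `BoundaryTransferWeak v`
applied to the periodic condensation statement for `v` delivered by
`WindowArithmetic SplittingConstruction DressedKacCondensation`. [folklore] -/
theorem becDressedKac_assembly_proof :
    Summit.AtomisticToContinuum.BoseEinsteinCondensation.Theses.BECDressedKac.Assembly := by
  unfold Theses.BECDressedKac.Assembly
  intro h₁ h₂ h₃ h₄ v hv
  exact h₄ v hv (h₃ h₁ h₂ v hv)

end Summit.AtomisticToContinuum.BoseEinsteinCondensation.Theorems
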